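import Summits.HubbardSuperconductivity.HubbardSuperconductivity.Theses.AposterioriCapRg

/-!
# Strategy census — Lean appendix (crux `CapRgSymmetricCertificatePinned`, stmt-HubbardSuperconductivity-14045)

Crux-strategist seat `planner-cstrat-stmt-HubbardSuperconductivity-14045-p1-0` (wall-breaker, gen 1,
2026-08-17).  Companion of `STRATEGY-CENSUS.md` in this directory.  Everything here is sorry-free and is
ATTEMPT EVIDENCE for the census headings, not a line of the crux:

* §1 DECOMPOSITION attempt, typed and glued: `DensityLocalisedOn U₀ μ₁ μ₂` (operator side) and
  `CertificateOnInterval U₀ μ₁ μ₂` (certificate side) with `capRg_of_subs : … → CapRgSymmetricCertificatePinned`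
  (the split is AVAILABLE; the census explains why it is not filed: the certificate leaf inherits the
  pinned numerals that every computation on the item finds infeasible, and the density leaf is the
  `± 0.01 t` equation-of-state wall of DENSITY_BRACKET_c4 / IDEATE-r2-k5 §4).
* §2 STRENGTHEN attempt, typed: `CapRgUniformFrame` (one frame and one scale serve EVERY tolerance) with
  `capRg_of_uniformFrame`; the census records why the added rigidity is itself suspect (Disproof A8: a
  finite-degree frame cannot make the Fermi-curve mismatch vanish identically).
* §3 NEGATION lens, the one NEW quantitative lever found by this seat, kinematic part kernel-checked:
  **band-rescaling covariance of the BCS normalisation** — for the SAME effective action `G`, rescaling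
  the renormalised band `e ↦ s·e` (`0 < s`) at nominal scale `Λ` reproduces the shell of `e` at scale
  `Λ/s` and multiplies the Cooper matrix by `1/s`:
  `cooperMatrix (s·e) Λ G = (1/s) • cooperMatrix e (Λ/s) G`, hence
  `pairingStrength (s·e) Λ G = (1/s) · pairingStrength e (Λ/s) G` (`pairingStrength_band_smul`).
  A FLATTER frame (`s < 1`) therefore INFLATES the certified `λ_d` by `1/s` at fixed physics; the census
  bounds `s` from below by the slope allowance (`s ≥ 2/3`, `flattening_floor_of_slopeAllowance`) and by
  the frame budget of `π₀` through the tree's own `coeffNorm` (`coeffNorm_flatteningFrame`: the frame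
  `c + (1-s)·ε` costs `|c| + 64|1-s|` at decay `4`, so `coeffNorm ≤ 10` with `|c| ≥ 4/5` forces
  `s ≥ 137/160`, `flattening_floor_of_frameBudget`) — an inflation of at most `160/137 ≈ 1.168`, short of
  the factor `≥ 1.28` the one-loop feasibility frontier needs (FEASIBILITY_14045 v2) and of the `≥ 1.25–1.5`
  needed inside the frame/van-Hove funnel (REFUTE-c3 §3).  So the lever does not flip the verdict; it is
  recorded as a statement-design hazard for the successor interface (a generous frame budget lets a
  producer inflate `λ_d` by up to `3/2`).
-/

noncomputable section

set_option linter.dupNamespace false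
set_option linter.unusedSectionVars false

namespace Summit.HubbardSuperconductivity.HubbardSuperconductivity.Cruxes.CapRgSymmetricCertificatePinned.StrategyCensus

open Literature.MathematicalPhysics.QuantumLattice Literature.Probability.LatticeModels Filter Finset Matrix
open Summit.HubbardSuperconductivity.HubbardSuperconductivity.Theses.AposterioriCapRg
open scoped BigOperators

/-! ## §1 Decomposition attempt: density localisation on an interval + certificate on the interval -/

/-- `Sub_D(U₀; μ₁, μ₂)`: at coupling `U₀` some `μ` STRICTLY INSIDE `(μ₁, μ₂)` has grand-canonical tracial
ground-state density converging to `1 - δ` for a `δ` of the box (the operator-model half of the crux,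
localised to an interval so that it decouples from the certificate half). -/
def DensityLocalisedOn (U₀ μ₁ μ₂ : ℝ) : Prop :=
  ∃ δ ∈ Set.Icc (1/5:ℝ) (7/20), ∃ μ ∈ Set.Ioo μ₁ μ₂,
    Tendsto (fun L : ℕ => ((hubbardTorusWith 2 (L + 1) 1 U₀ μ).groundStateFunctional totalNumber).re /
      ((L + 1 : ℕ) : ℝ) ^ 2) atTop (nhds (1 - δ))

/-- `Sub_C(U₀; μ₁, μ₂)`: the pinned certificate holds at EVERY `μ` of the open interval, to every
tolerance (the Grassmann-model half, made `μ`-uniform so that it does not need to know which `μ` the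
density clause picks). -/
def CertificateOnInterval (U₀ μ₁ μ₂ : ℝ) : Prop :=
  ∀ μ ∈ Set.Ioo μ₁ μ₂, ∀ Θ : SymmetricTolerance, ∃ (K : TrigPolyC4v) (Λ : ℝ) (L₀ : ℕ),
    symmetricRegimeCertificateT U₀ μ capRgCornerDataT Θ K Λ L₀

/-- **The typed split glues**: `Sub_D ∧ Sub_C ⇒` the crux, for any admissible `U₀` and any interval.
(Pure logic; this is the shape of the landed `stub_certificateOnInterval` cut of the dead line
strict-continuum v4, lifted to sub-crux level.) -/
theorem capRg_of_subs {U₀ μ₁ μ₂ : ℝ} (hU : U₀ ∈ Set.Icc (2:ℝ) 3)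
    (hD : DensityLocalisedOn U₀ μ₁ μ₂) (hC : CertificateOnInterval U₀ μ₁ μ₂) :
    CapRgSymmetricCertificatePinned := by
  obtain ⟨δ, hδ, μ, hμ, hdens⟩ := hD
  exact ⟨U₀, hU, δ, hδ, μ, hdens, fun Θ => hC μ hμ Θ⟩

/-! ## §2 Strengthen attempt: a tolerance-uniform frame and scale -/

/-- `S⁺`: ONE frame `K`, ONE scale `Λ` and ONE `L₀` certify the point to EVERY tolerance `Θ = (c₀, w)`
(quantifiers `∃ K Λ L₀ ∀ Θ` instead of `∀ Θ ∃ K Λ L₀`).  Strictly stronger than the crux; the census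
records why the rigidity buys nothing (it asks the Fermi-curve mismatch of a FINITE-degree frame to
vanish in the iterated limit, Disproof A8). -/
def CapRgUniformFrame : Prop :=
  ∃ U ∈ Set.Icc (2:ℝ) 3, ∃ δ ∈ Set.Icc (1/5:ℝ) (7/20), ∃ μ : ℝ,
    Tendsto (fun L : ℕ => ((hubbardTorusWith 2 (L + 1) 1 U μ).groundStateFunctional totalNumber).re /
      ((L + 1 : ℕ) : ℝ) ^ 2) atTop (nhds (1 - δ)) ∧
    ∃ (K : TrigPolyC4v) (Λ : ℝ) (L₀ : ℕ), ∀ Θ : SymmetricTolerance,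
      symmetricRegimeCertificateT U μ capRgCornerDataT Θ K Λ L₀

/-- `S⁺ ⇒ S`. -/
theorem capRg_of_uniformFrame (h : CapRgUniformFrame) : CapRgSymmetricCertificatePinned := by
  obtain ⟨U, hU, δ, hδ, μ, hdens, K, Λ, L₀, hall⟩ := h
  exact ⟨U, hU, δ, hδ, μ, hdens, fun Θ => ⟨K, Λ, L₀, hall Θ⟩⟩

/-! ## §3 Negation lens: band-rescaling covariance of the BCS normalisation (the frame-velocity lever) -/

section Lever

variable {L M : ℕ} [NeZero L] [NeZero M]

/-- Rescaling the band by `s > 0` at nominal scale `Λ` gives the shell of the original band at `Λ/s`. -/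
theorem momentumShell_band_smul {s : ℝ} (hs : 0 < s) (e : TorusSite 2 L → ℝ) (Λ : ℝ) :
    momentumShell L (fun k => s * e k) Λ = momentumShell L e (Λ / s) := by
  ext k
  simp only [mem_momentumShell, abs_mul, abs_of_pos hs]
  rw [le_div_iff₀ hs, mul_comm]

/-- The BCS measure at scale `Λ/s` is `s` times the BCS measure at scale `Λ` (same `G`, same `β`). -/
theorem bcsMeasure_scale_div {s : ℝ} (hs : 0 < s) (β Λ : ℝ) (G : HubbardGrassmann L M) (k : TorusSite 2 L) :
    bcsMeasure L M β (Λ / s) G k = s * bcsMeasure L M β Λ G k := by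
  unfold bcsMeasure
  have hs' : s ≠ 0 := hs.ne'
  field_simp

/-- **Band-rescaling covariance of the Cooper matrix**: for the SAME effective action `G`,
`A[s·e, Λ] = (1/s) • A[e, Λ/s]`. -/
theorem cooperMatrix_band_smul {s : ℝ} (hs : 0 < s) (β Λ : ℝ) (e : TorusSite 2 L → ℝ)
    (G : HubbardGrassmann L M) :
    cooperMatrix L M β (fun k => s * e k) Λ G = ((1 / s : ℝ) : ℂ) • cooperMatrix L M β e (Λ / s) G := by
  ext k k'
  simp only [cooperMatrix, Matrix.smul_apply, Matrix.of_apply, momentumShell_band_smul hs, smul_eq_mul]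
  split_ifs with h
  · rw [bcsMeasure_scale_div hs, bcsMeasure_scale_div hs, Real.sqrt_mul hs.le, Real.sqrt_mul hs.le]
    have hsq : Real.sqrt s * Real.sqrt s = s := Real.mul_self_sqrt hs.le
    have hs' : (s : ℂ) ≠ 0 := by exact_mod_cast hs.ne'
    have key : ((1 / s : ℝ) : ℂ) * (((Real.sqrt s : ℝ) : ℂ) * ((Real.sqrt s : ℝ) : ℂ)) = 1 := by
      rw [← Complex.ofReal_mul, hsq]; push_cast; field_simp
    set a := ((Real.sqrt (bcsMeasure L M β Λ G k) : ℝ) : ℂ)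
    set b := ((Real.sqrt (bcsMeasure L M β Λ G k') : ℝ) : ℂ)
    set c := cooperAmplitude L M β G k k'
    set r := ((Real.sqrt s : ℝ) : ℂ)
    calc a * c * b = (((1 / s : ℝ) : ℂ) * (r * r)) * (a * c * b) := by rw [key, one_mul]
      _ = ((1 / s : ℝ) : ℂ) * ((r * a : ℂ) * c * (r * b)) := by ring
      _ = _ := by push_cast; ring
  · simp

/-- Rayleigh quotients are homogeneous under real scalings of the matrix. -/
theorem re_rayleigh_real_smul {m : Type*} [Fintype m] (c : ℝ) (A : Matrix m m ℂ) (v : m → ℂ) :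
    (star v ⬝ᵥ (((c : ℂ) • A) *ᵥ v)).re = c * (star v ⬝ᵥ (A *ᵥ v)).re := by
  rw [Matrix.smul_mulVec, dotProduct_smul, smul_eq_mul, Complex.re_ofReal_mul]

/-- `supRayleigh` is positively homogeneous: `sup Re⟨v, (cA)v⟩ = c · sup Re⟨v, Av⟩` for `c ≥ 0`
(no boundedness hypothesis needed: `Real.mul_iSup_of_nonneg`). -/
theorem supRayleigh_real_smul {m : Type*} [Fintype m] {c : ℝ} (hc : 0 ≤ c) (A : Matrix m m ℂ) :
    ((c : ℂ) • A).supRayleigh = c * A.supRayleigh := by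
  unfold Matrix.supRayleigh
  rw [Real.mul_iSup_of_nonneg hc]
  exact iSup_congr fun v => re_rayleigh_real_smul c A v.1

/-- **Band-rescaling covariance of the pairing strength** (the frame-velocity lever, kinematic part):
for the SAME effective action `G`, `λ_d[s·e, Λ] = (1/s) · λ_d[e, Λ/s]`.  A flatter renormalised band
(`s < 1`) at the same nominal scale reports a LARGER `λ_d` for the same physics: the BCS normalisation
`ν = 1/(ΛL²(z+z̄))` reads the NOMINAL `Λ`, while the shell is set by the band. -/
theorem pairingStrength_band_smul {s : ℝ} (hs : 0 < s) (β Λ : ℝ) (e : TorusSite 2 L → ℝ)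
    (G : HubbardGrassmann L M) :
    pairingStrength L M β (fun k => s * e k) Λ G = (1 / s) * pairingStrength L M β e (Λ / s) G := by
  unfold pairingStrength
  rw [cooperMatrix_band_smul hs, ← smul_neg]
  exact supRayleigh_real_smul (by positivity) _

end Lever

/-! ### §3′ The two floors on the flattening factor `s` (arithmetic of the census, §Negation) -/

/-- Slope allowance `c₁ = 1/2` of `π₀`: a frame flattened by `s` carries `Re Σ = ((1-s)/s)·e_K` on the
shell, admissible under (0b′) (as `c₀ → 0`) iff `(1-s)/s ≤ 1/2`, i.e. iff `s ≥ 2/3`. -/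
theorem flattening_floor_of_slopeAllowance {s : ℝ} (hs : 0 < s) :
    (1 - s) / s ≤ 1 / 2 ↔ 2 / 3 ≤ s := by
  rw [div_le_iff₀ hs]
  constructor <;> intro h <;> linarith

/-- The flattening frame `K = c·h₀₀ + κ·h₁₀` as a `TrigPolyC4v` of degree `1` (`h₁₀ = ½(cos p₁ + cos p₂)
= -ε/4`, so `(1-s)·ε` is `κ = -4(1-s)`). -/
def flatteningFrame (c κ : ℝ) : TrigPolyC4v :=
  ⟨1, fun m n => if m = 0 ∧ n = 0 then c else if m = 1 ∧ n = 0 then κ else 0⟩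

/-- **Price of flattening in the tree's frame norm**: `coeffNorm 4 (c·h₀₀ + κ·h₁₀) = |c| + 16|κ|`; with
`κ = -4(1-s)` this is `|c| + 64|1-s|`. -/
theorem coeffNorm_flatteningFrame (c κ : ℝ) :
    (flatteningFrame c κ).coeffNorm 4 = |c| + 16 * |κ| := by
  simp [flatteningFrame, TrigPolyC4v.coeffNorm, Finset.sum_range_succ]
  norm_num

/-- With the constant (Hartree-type) part `|c| ≥ 4/5` and the budget `coeffNorm 4 ≤ 10` of `π₀`, the
flattening `κ = -4(1-s)`, `s ≤ 1`, is admissible only if `s ≥ 137/160 = 0.85625`: the certified `λ_d`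
can be inflated through the frame by at most `160/137 < 1.17`. -/
theorem flattening_floor_of_frameBudget {c s : ℝ} (hc : 4 / 5 ≤ |c|) (hs : s ≤ 1)
    (hK : (flatteningFrame c (-4 * (1 - s))).coeffNorm 4 ≤ 10) : 137 / 160 ≤ s := by
  rw [coeffNorm_flatteningFrame] at hK
  have h1 : |(-4 : ℝ) * (1 - s)| = 4 * (1 - s) := by
    rw [abs_mul, abs_of_nonneg (by linarith : (0:ℝ) ≤ 1 - s)]; norm_num
  rw [h1] at hK
  linarith

end Summit.HubbardSuperconductivity.HubbardSuperconductivity.Cruxes.CapRgSymmetricCertificatePinned.StrategyCensus
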